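import Mathlib
import HarnessLib
import Literature.MathematicalPhysics.QuantumFieldTheory.ConstructiveQFTWave0
import Literature.MathematicalPhysics.QuantumFieldTheory.LatticeGaugeProofs
import Literature.MathematicalPhysics.QuantumFieldTheory.StrongCouplingActivities
import Summits.Ventures.LatticeQCDFlow.Scaling.PlaquetteIndependence2D
import Summits.Ventures.LatticeQCDFlow.Scaling.PlaquetteMarginals2D
import Summits.Ventures.LatticeQCDFlow.Scaling.PlaquetteDecorrelationTwoDimU1

/-!
# LatticeQCDFlow / Scaling — two dimensions, ANY compact gauge group: two plaquette observables of the Wilson measure decorrelate exponentially in the volume, uniformly in their positions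

HONEST FRAMING: exact (Metropolis-corrected) sampling algorithms for lattice gauge theory; figures of merit are
autocorrelation/cost numbers at stated couplings and volumes; no continuum-physics claim.

Venture `LatticeQCDFlow` (cell pub-lqcd), topic `Scaling`, FANOUT row 30 (lean-1) — OUR WORK, the general-group
version of `Scaling/PlaquetteDecorrelationTwoDimU1.lean` (which treated `U(1)`, `β ≥ 0`, through Haar-convolution
flatness).  Here: EVERY compact second-countable `G`, every measurable one-plaquette weight `w` pinched between two
positive constants `c ≤ w ≤ s` — in particular the Wilson weight `e^{−β(N − Re tr ρ(g))}` of any continuous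
representation `ρ` at ANY real `β` — on the torus `(ℤ/L)²`, `L ≥ 2`.

THE ONE-BAD-SET EXPANSION.  Write `w = c + v` (`v ≥ 0`) on the `A − 2` plaquettes OTHER than the observed pair
`p ≠ p'` and expand: `∏_{x ≠ p,p'} w(U_x) = Σ_{t ⊆ Λ∖{p,p'}} c^{A−2−#t} ∏_{x∈t} v(U_x)`.  For every `t` EXCEPT the full
bulk `t = Λ ∖ {p, p'}` some plaquette `x₀ ∉ t ∪ {p, p'}` carries no factor, and by lean-1's puncture theorem
(`PlaquetteMarginals2D.lintegral_comp_plaquettes_eq_pi`: off one puncture the plaquettes of ANY compact group are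
i.i.d. Haar) the `t`-term of `∫ Φ(U_p)Ψ(U_{p'}) ∏ w` equals its value under the PRODUCT law `Haar^{⊗Λ}`; the single bad
term is at most `s·(product value with one factor fewer)`.  Summing the binomial (`Finset.sum_pow_mul_eq_add_pow`):

* `lintegral_pi_pair_prod` — product-law integrals factorise: `∫ Φ(g_p)Ψ(g_{p'})∏_{x∈t} v(g_x) dHaar^{⊗Λ} = m(Φ)m(Ψ)m(v)^{#t}`;
* `lintegral_pair_prod_eq_pi` — the `t`-term is the product value whenever a puncture `x₀ ∉ t ∪ {p,p'}` exists;
* **`pair_lintegral_upper`**, **`pair_lintegral_lower`** — with `a = m(Φw)`, `b = m(Ψw)`, `y = m(w) − c`... precisely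
  `y = m(v)`, `z = c + y = m(w)`:  `N := ∫ Φ(U_p)Ψ(U_{p'})∏_x w(U_x) dHaar^{⊗E} ≤ a·b·(z^{A−2} + s·y^{A−3})` and
  `a·b·z^{A−2} ≤ N + a·b·y^{A−2}` — i.e. `N = a b z^{A−2}(1 + O((y/z)^{A−3}))`, `y/z = 1 − c/m(w) < 1`.

So every pair expectation of the normalised measure `(∏_x w(U_x)) Haar^{⊗E}/Z` is within the factor
`r_A^{±1}`, `r_A = (1 − q^{A−2})/(1 + (s/z) q^{A−3}) → 1` EXPONENTIALLY in the volume `A = L²` (`q = y/z`), of its value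
under independent one-plaquette laws `w dHaar/z`; the real-valued covariance bound and the Wilson specialisation are
`Scaling/CorrelatorFloorTwoDim.lean`.  NOT CLAIMED: `d ≥ 3` (there the plaquettes off a puncture are NOT independent).
Literature grade: known (two-dimensional lattice gauge theory is solvable; Migdal 1975, Gross–Witten 1980); new = a
character-free, kernel-checked proof for every compact group.  Elementary; nothing here is cited as a fact; no `def`,
no `sorry`.
-/

noncomputable section

namespace Summit.Ventures.LatticeQCDFlow.Theory2.Lattice.TwoDim

open MeasureTheory Filter Topology Literature.MathematicalPhysics.QuantumFieldTheory
open scoped ENNReal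

variable {L : ℕ} {G : Type*} [Group G] [TopologicalSpace G] [IsTopologicalGroup G] [CompactSpace G]
  [SecondCountableTopology G] [MeasurableSpace G] [BorelSpace G]

/-! ## §1. Product-law integrals of pair-times-bulk observables -/

omit [Group G] [TopologicalSpace G] [IsTopologicalGroup G] [CompactSpace G] [SecondCountableTopology G]
  [BorelSpace G] in
/-- A constant choice between a measurable function and `1` is measurable. [folklore] -/
theorem measurable_ite_const {P : Prop} [Decidable P] {Φ : G → ℝ≥0∞} (hΦ : Measurable Φ) :
    Measurable fun u : G => if P then Φ u else 1 := by
  by_cases h : P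
  · simp only [h, if_true]; exact hΦ
  · simp only [h, if_false]; exact measurable_const

omit [SecondCountableTopology G] in
/-- **Product-law integrals factorise**: for `p ≠ p'` off `t`,
`∫ Φ(g_p)Ψ(g_{p'})∏_{x∈t} v(g_x) dHaar^{⊗Λ}(g) = m(Φ)·m(Ψ)·m(v)^{#t}` (`m` = Haar mean). [folklore] -/
theorem lintegral_pi_pair_prod [NeZero L] {p p' : Site 2 L} (hpp' : p ≠ p') (t : Finset (Site 2 L))
    (hpt : p ∉ t) (hp't : p' ∉ t) {Φ Ψ v : G → ℝ≥0∞} (hΦ : Measurable Φ) (hΨ : Measurable Ψ)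
    (hv : Measurable v) :
    ∫⁻ g, Φ (g p) * Ψ (g p') * ∏ x ∈ t, v (g x) ∂(Measure.pi fun _ : Site 2 L => haarProbability G) =
      (∫⁻ u, Φ u ∂(haarProbability G)) * (∫⁻ u, Ψ u ∂(haarProbability G)) *
        (∫⁻ u, v u ∂(haarProbability G)) ^ t.card := by
  classical
  set F : Site 2 L → G → ℝ≥0∞ := fun i u =>
    (if i = p then Φ u else 1) * ((if i = p' then Ψ u else 1) * (if i ∈ t then v u else 1)) with hF
  have hFm : ∀ i, Measurable (F i) := fun i =>
    (measurable_ite_const hΦ).mul ((measurable_ite_const hΨ).mul (measurable_ite_const hv))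
  have hprod : ∀ g : Site 2 L → G, Φ (g p) * Ψ (g p') * ∏ x ∈ t, v (g x) = ∏ i, F i (g i) := by
    intro g
    simp only [hF, Finset.prod_mul_distrib]
    rw [Finset.prod_ite_eq' Finset.univ p (fun i => Φ (g i)), if_pos (Finset.mem_univ _),
      Finset.prod_ite_eq' Finset.univ p' (fun i => Ψ (g i)), if_pos (Finset.mem_univ _),
      Fintype.prod_extend_by_one, mul_assoc]
  have hint : ∀ i, ∫⁻ u, F i u ∂(haarProbability G) =
      (if i = p then ∫⁻ u, Φ u ∂(haarProbability G) else 1) *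
        ((if i = p' then ∫⁻ u, Ψ u ∂(haarProbability G) else 1) *
          (if i ∈ t then ∫⁻ u, v u ∂(haarProbability G) else 1)) := by
    intro i
    by_cases h1 : i = p
    · subst h1
      simp only [hF, if_true, hpp', if_false, hpt, mul_one]
    · by_cases h2 : i = p'
      · subst h2
        simp only [hF, h1, if_false, if_true, hp't, one_mul, mul_one]
      · by_cases h3 : i ∈ t
        · simp only [hF, h1, h2, h3, if_false, if_true, one_mul]
        · simp only [hF, h1, h2, h3, if_false, lintegral_const, measure_univ, mul_one]
  simp_rw [hprod]
  rw [GaussianToolkit.lintegral_fintype_prod_eq_prod (fun _ : Site 2 L => haarProbability G) hFm]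
  simp_rw [hint]
  rw [Finset.prod_mul_distrib, Finset.prod_mul_distrib,
    Finset.prod_ite_eq' Finset.univ p (fun _ => ∫⁻ u, Φ u ∂(haarProbability G)), if_pos (Finset.mem_univ _),
    Finset.prod_ite_eq' Finset.univ p' (fun _ => ∫⁻ u, Ψ u ∂(haarProbability G)), if_pos (Finset.mem_univ _),
    Fintype.prod_extend_by_one, Finset.prod_const, mul_assoc]

/-! ## §2. Good sets: a free puncture makes the term a product-law integral -/

/-- **A `t`-term with a free puncture is its product-law value**: if some `x₀ ∉ t ∪ {p, p'}` then
`∫ Φ(U_p)Ψ(U_{p'})∏_{x∈t} v(U_x) dHaar^{⊗E} = ∫ Φ(g_p)Ψ(g_{p'})∏_{x∈t} v(g_x) dHaar^{⊗Λ}` (any compact `G`). [folklore] -/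
theorem lintegral_pair_prod_eq_pi [NeZero L] (hL : 2 ≤ L) {p p' x₀ : Site 2 L} (t : Finset (Site 2 L))
    (hx₀t : x₀ ∉ t) (hx₀p : x₀ ≠ p) (hx₀p' : x₀ ≠ p') {Φ Ψ v : G → ℝ≥0∞} (hΦ : Measurable Φ)
    (hΨ : Measurable Ψ) (hv : Measurable v) :
    ∫⁻ U, Φ (plaquetteHolonomy U p 0 1) * Ψ (plaquetteHolonomy U p' 0 1) *
        ∏ x ∈ t, v (plaquetteHolonomy U x 0 1) ∂(Measure.pi fun _ : Edge 2 L => haarProbability G) =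
      ∫⁻ g, Φ (g p) * Ψ (g p') * ∏ x ∈ t, v (g x) ∂(Measure.pi fun _ : Site 2 L => haarProbability G) := by
  have hHm : Measurable fun g : Site 2 L → G => Φ (g p) * Ψ (g p') * ∏ x ∈ t, v (g x) :=
    ((hΦ.comp (measurable_pi_apply p)).mul (hΨ.comp (measurable_pi_apply p'))).mul
      (Finset.measurable_prod _ fun i _ => hv.comp (measurable_pi_apply i))
  have hH : ∀ (g : Site 2 L → G) (u : G),
      Φ (Function.update g x₀ u p) * Ψ (Function.update g x₀ u p') * ∏ x ∈ t, v (Function.update g x₀ u x) =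
        Φ (g p) * Ψ (g p') * ∏ x ∈ t, v (g x) := by
    intro g u
    rw [Function.update_of_ne hx₀p.symm, Function.update_of_ne hx₀p'.symm,
      Finset.prod_congr rfl fun x hx => by rw [Function.update_of_ne (ne_of_mem_of_not_mem hx hx₀t)]]
  exact lintegral_comp_plaquettes_eq_pi hL x₀ (H := fun g => Φ (g p) * Ψ (g p') * ∏ x ∈ t, v (g x)) hHm hH

/-! ## §3. The one-bad-set expansion: two-sided bounds on a pair integral against the product law -/

/-- The bulk `Λ ∖ {p, p'}` of a pair. [folklore] -/
theorem bulk_props [NeZero L] {p p' : Site 2 L} (hpp' : p ≠ p') :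
    p ∉ (Finset.univ.erase p).erase p' ∧ p' ∉ (Finset.univ.erase p).erase p' ∧
      ((Finset.univ.erase p).erase p').card = L ^ 2 - 2 := by
  refine ⟨fun h => ?_, Finset.notMem_erase _ _, ?_⟩
  · exact Finset.notMem_erase p Finset.univ (Finset.mem_of_mem_erase h)
  · rw [Finset.card_erase_of_mem (Finset.mem_erase.mpr ⟨hpp'.symm, Finset.mem_univ _⟩),
      Finset.card_erase_of_mem (Finset.mem_univ _), Finset.card_univ, Fintype.card_fun, ZMod.card,
      Fintype.card_fin, Nat.sub_sub]

omit [Group G] [TopologicalSpace G] [IsTopologicalGroup G] [CompactSpace G] [SecondCountableTopology G]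
  [MeasurableSpace G] [BorelSpace G] in
/-- The weight as bulk expansion: `Φ(U_p)Ψ(U_{p'})∏_x (c + v(U_x)) = Σ_{t ⊆ bulk} c^{#bulk−#t}·Φ̂(U_p)Ψ̂(U_{p'})∏_{x∈t} v(U_x)`
with `Φ̂ = Φ·(c+v)`, `Ψ̂ = Ψ·(c+v)`. [folklore] -/
theorem pair_weight_expansion [NeZero L] {p p' : Site 2 L} (hpp' : p ≠ p') (c : ℝ≥0∞) (v Φ Ψ : G → ℝ≥0∞)
    (g : Site 2 L → G) :
    Φ (g p) * Ψ (g p') * ∏ x, (c + v (g x)) =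
      ∑ t ∈ ((Finset.univ.erase p).erase p').powerset,
        c ^ (((Finset.univ.erase p).erase p').card - t.card) *
          (Φ (g p) * (c + v (g p)) * (Ψ (g p') * (c + v (g p'))) * ∏ x ∈ t, v (g x)) := by
  classical
  set B := (Finset.univ.erase p).erase p' with hB
  have hp' : p' ∈ Finset.univ.erase p := Finset.mem_erase.mpr ⟨hpp'.symm, Finset.mem_univ _⟩
  rw [← Finset.mul_prod_erase Finset.univ (fun x => c + v (g x)) (Finset.mem_univ p),
    ← Finset.mul_prod_erase (Finset.univ.erase p) (fun x => c + v (g x)) hp']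
  have hexp : ∏ x ∈ B, (c + v (g x)) = ∑ t ∈ B.powerset, c ^ (B.card - t.card) * ∏ x ∈ t, v (g x) := by
    have h1 : ∏ x ∈ B, (c + v (g x)) = ∏ x ∈ B, (v (g x) + c) :=
      Finset.prod_congr rfl fun x _ => add_comm _ _
    rw [h1, Finset.prod_add]
    refine Finset.sum_congr rfl fun t ht => ?_
    rw [Finset.prod_const, Finset.card_sdiff_of_subset (Finset.mem_powerset.mp ht), mul_comm]
  rw [← hB, hexp]
  simp only [Finset.mul_sum]
  refine Finset.sum_congr rfl fun t _ => ?_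
  ring

/-- **PAIR INTEGRAL, UPPER BOUND** (2-d, any compact `G`, `L ≥ 2`, weight `w = c + v` with `v ≤ s`, `p ≠ p'`,
`Φ, Ψ ≥ 0` measurable): with `a = m(Φw)`, `b = m(Ψw)`, `y = m(v)`,
`∫ Φ(U_p)Ψ(U_{p'})∏_x w(U_x) dHaar^{⊗E} ≤ a·b·((c + y)^{L²−2} + s·y^{L²−3})`. [folklore] -/
theorem pair_lintegral_upper [NeZero L] (hL : 2 ≤ L) {p p' : Site 2 L} (hpp' : p ≠ p') (c : ℝ≥0∞)
    {v Φ Ψ : G → ℝ≥0∞} (hv : Measurable v) (hΦ : Measurable Φ) (hΨ : Measurable Ψ) {s : ℝ≥0∞}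
    (hs : ∀ u, v u ≤ s) :
    ∫⁻ U, Φ (plaquetteHolonomy U p 0 1) * Ψ (plaquetteHolonomy U p' 0 1) *
        ∏ x, (c + v (plaquetteHolonomy U x 0 1)) ∂(Measure.pi fun _ : Edge 2 L => haarProbability G) ≤
      (∫⁻ u, Φ u * (c + v u) ∂(haarProbability G)) * (∫⁻ u, Ψ u * (c + v u) ∂(haarProbability G)) *
        ((c + ∫⁻ u, v u ∂(haarProbability G)) ^ (L ^ 2 - 2) +
          s * (∫⁻ u, v u ∂(haarProbability G)) ^ (L ^ 2 - 3)) := by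
  classical
  obtain ⟨hpB, hp'B, hBcard⟩ := bulk_props (L := L) hpp'
  set B := (Finset.univ.erase p).erase p' with hB
  set a := ∫⁻ u, Φ u * (c + v u) ∂(haarProbability G) with ha
  set b := ∫⁻ u, Ψ u * (c + v u) ∂(haarProbability G) with hb
  set y := ∫⁻ u, v u ∂(haarProbability G) with hy
  have hw : Measurable fun u => c + v u := measurable_const.add hv
  have hΦw : Measurable fun u => Φ u * (c + v u) := hΦ.mul hw
  have hΨw : Measurable fun u => Ψ u * (c + v u) := hΨ.mul hw
  -- a point of the bulk (`L² ≥ 4 > 2`)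
  have hBne : B.Nonempty := by
    rw [← Finset.card_pos, hBcard]
    have : 4 ≤ L ^ 2 := by nlinarith
    omega
  obtain ⟨x₀, hx₀⟩ := hBne
  have hx₀p : x₀ ≠ p := fun h => hpB (h ▸ hx₀)
  have hx₀p' : x₀ ≠ p' := fun h => hp'B (h ▸ hx₀)
  -- the terms
  set T : Finset (Site 2 L) → ℝ≥0∞ := fun t =>
    ∫⁻ U, Φ (plaquetteHolonomy U p 0 1) * (c + v (plaquetteHolonomy U p 0 1)) *
        (Ψ (plaquetteHolonomy U p' 0 1) * (c + v (plaquetteHolonomy U p' 0 1))) *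
      ∏ x ∈ t, v (plaquetteHolonomy U x 0 1) ∂(Measure.pi fun _ : Edge 2 L => haarProbability G) with hT
  have hmeasT : ∀ t : Finset (Site 2 L), Measurable fun U : GaugeConfig 2 L G =>
      Φ (plaquetteHolonomy U p 0 1) * (c + v (plaquetteHolonomy U p 0 1)) *
        (Ψ (plaquetteHolonomy U p' 0 1) * (c + v (plaquetteHolonomy U p' 0 1))) *
      ∏ x ∈ t, v (plaquetteHolonomy U x 0 1) := fun t =>
    ((hΦw.comp (measurable_plaquetteHolonomy p)).mul (hΨw.comp (measurable_plaquetteHolonomy p'))).mul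
      (Finset.measurable_prod _ fun i _ => hv.comp (measurable_plaquetteHolonomy i))
  -- Step 1: expand and integrate termwise
  have hN : ∫⁻ U, Φ (plaquetteHolonomy U p 0 1) * Ψ (plaquetteHolonomy U p' 0 1) *
        ∏ x, (c + v (plaquetteHolonomy U x 0 1)) ∂(Measure.pi fun _ : Edge 2 L => haarProbability G) =
      ∑ t ∈ B.powerset, c ^ (B.card - t.card) * T t := by
    have h1 : ∀ U : GaugeConfig 2 L G, Φ (plaquetteHolonomy U p 0 1) * Ψ (plaquetteHolonomy U p' 0 1) *
        ∏ x, (c + v (plaquetteHolonomy U x 0 1)) = ∑ t ∈ B.powerset, c ^ (B.card - t.card) *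
          (Φ (plaquetteHolonomy U p 0 1) * (c + v (plaquetteHolonomy U p 0 1)) *
            (Ψ (plaquetteHolonomy U p' 0 1) * (c + v (plaquetteHolonomy U p' 0 1))) *
          ∏ x ∈ t, v (plaquetteHolonomy U x 0 1)) := fun U =>
      pair_weight_expansion hpp' c v Φ Ψ (fun x => plaquetteHolonomy U x 0 1)
    simp_rw [h1]
    rw [lintegral_finsetSum _ fun t _ => (hmeasT t).const_mul _]
    refine Finset.sum_congr rfl fun t _ => ?_
    rw [lintegral_const_mul _ (hmeasT t)]
  -- Step 2: good terms are product values, the bad term is at most `s ·` a product value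
  have hgood : ∀ t ∈ B.powerset, t ≠ B → T t = a * b * y ^ t.card := by
    intro t ht hne
    have hsub : t ⊆ B := Finset.mem_powerset.mp ht
    obtain ⟨x₁, hx₁B, hx₁t⟩ := Finset.exists_of_ssubset (Finset.ssubset_iff_subset_ne.mpr ⟨hsub, hne⟩)
    have hx₁p : x₁ ≠ p := fun h => hpB (h ▸ hx₁B)
    have hx₁p' : x₁ ≠ p' := fun h => hp'B (h ▸ hx₁B)
    rw [hT]
    simp only
    rw [lintegral_pair_prod_eq_pi hL t hx₁t hx₁p hx₁p' hΦw hΨw hv,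
      lintegral_pi_pair_prod hpp' t (fun h => hpB (hsub h)) (fun h => hp'B (hsub h)) hΦw hΨw hv]
  have hbad : T B ≤ s * (a * b * y ^ (L ^ 2 - 3)) := by
    have hsub : B.erase x₀ ⊆ B := Finset.erase_subset _ _
    have hcard : (B.erase x₀).card = L ^ 2 - 3 := by rw [Finset.card_erase_of_mem hx₀, hBcard, Nat.sub_sub]
    have hstep : T B ≤ s * T (B.erase x₀) := by
      have hpt : ∀ U : GaugeConfig 2 L G,
          Φ (plaquetteHolonomy U p 0 1) * (c + v (plaquetteHolonomy U p 0 1)) *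
              (Ψ (plaquetteHolonomy U p' 0 1) * (c + v (plaquetteHolonomy U p' 0 1))) *
            ∏ x ∈ B, v (plaquetteHolonomy U x 0 1) ≤
          s * (Φ (plaquetteHolonomy U p 0 1) * (c + v (plaquetteHolonomy U p 0 1)) *
              (Ψ (plaquetteHolonomy U p' 0 1) * (c + v (plaquetteHolonomy U p' 0 1))) *
            ∏ x ∈ B.erase x₀, v (plaquetteHolonomy U x 0 1)) := by
        intro U
        rw [← Finset.mul_prod_erase B (fun x => v (plaquetteHolonomy U x 0 1)) hx₀]
        set X := Φ (plaquetteHolonomy U p 0 1) * (c + v (plaquetteHolonomy U p 0 1)) *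
              (Ψ (plaquetteHolonomy U p' 0 1) * (c + v (plaquetteHolonomy U p' 0 1)))
        set P := ∏ x ∈ B.erase x₀, v (plaquetteHolonomy U x 0 1)
        calc X * (v (plaquetteHolonomy U x₀ 0 1) * P) = v (plaquetteHolonomy U x₀ 0 1) * (X * P) := by ring
          _ ≤ s * (X * P) := mul_le_mul_left (hs _) _
      calc T B = ∫⁻ U, Φ (plaquetteHolonomy U p 0 1) * (c + v (plaquetteHolonomy U p 0 1)) *
              (Ψ (plaquetteHolonomy U p' 0 1) * (c + v (plaquetteHolonomy U p' 0 1))) *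
            ∏ x ∈ B, v (plaquetteHolonomy U x 0 1) ∂(Measure.pi fun _ : Edge 2 L => haarProbability G) := rfl
        _ ≤ ∫⁻ U, s * (Φ (plaquetteHolonomy U p 0 1) * (c + v (plaquetteHolonomy U p 0 1)) *
              (Ψ (plaquetteHolonomy U p' 0 1) * (c + v (plaquetteHolonomy U p' 0 1))) *
            ∏ x ∈ B.erase x₀, v (plaquetteHolonomy U x 0 1)) ∂(Measure.pi fun _ : Edge 2 L => haarProbability G) :=
            lintegral_mono fun U => hpt U
        _ = s * T (B.erase x₀) := by rw [lintegral_const_mul _ (hmeasT _)]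
    have hgoodE : T (B.erase x₀) = a * b * y ^ (L ^ 2 - 3) := by
      rw [hT]
      simp only
      rw [lintegral_pair_prod_eq_pi hL (B.erase x₀) (Finset.notMem_erase x₀ B) hx₀p hx₀p' hΦw hΨw hv,
        lintegral_pi_pair_prod hpp' (B.erase x₀) (fun h => hpB (hsub h)) (fun h => hp'B (hsub h)) hΦw hΨw hv,
        hcard]
    rw [hgoodE] at hstep
    exact hstep
  -- Step 3: sum up
  have hBmem : B ∈ B.powerset := Finset.mem_powerset.mpr (Finset.Subset.refl _)
  have hbinom : ∑ t ∈ B.powerset, c ^ (B.card - t.card) * (a * b * y ^ t.card) = a * b * (c + y) ^ (L ^ 2 - 2) := by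
    rw [← hBcard, add_comm c y, ← Finset.sum_pow_mul_eq_add_pow y c B, Finset.mul_sum]
    refine Finset.sum_congr rfl fun t _ => ?_
    ring
  rw [hN]
  calc ∑ t ∈ B.powerset, c ^ (B.card - t.card) * T t
      ≤ ∑ t ∈ B.powerset, (c ^ (B.card - t.card) * (a * b * y ^ t.card) +
          (if t = B then s * (a * b * y ^ (L ^ 2 - 3)) else 0)) := by
        refine Finset.sum_le_sum fun t ht => ?_
        by_cases hte : t = B
        · rw [if_pos hte, hte, Nat.sub_self, pow_zero, one_mul, one_mul]
          exact hbad.trans le_add_self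
        · rw [if_neg hte, add_zero, hgood t ht hte]
    _ = a * b * (c + y) ^ (L ^ 2 - 2) + s * (a * b * y ^ (L ^ 2 - 3)) := by
        rw [Finset.sum_add_distrib, hbinom, Finset.sum_ite_eq' B.powerset B, if_pos hBmem]
    _ = _ := by ring

/-- **PAIR INTEGRAL, LOWER BOUND**: `a·b·(c + y)^{L²−2} ≤ ∫ Φ(U_p)Ψ(U_{p'})∏_x w(U_x) dHaar^{⊗E} + a·b·y^{L²−2}`. [folklore] -/
theorem pair_lintegral_lower [NeZero L] (hL : 2 ≤ L) {p p' : Site 2 L} (hpp' : p ≠ p') (c : ℝ≥0∞)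
    {v Φ Ψ : G → ℝ≥0∞} (hv : Measurable v) (hΦ : Measurable Φ) (hΨ : Measurable Ψ) :
    (∫⁻ u, Φ u * (c + v u) ∂(haarProbability G)) * (∫⁻ u, Ψ u * (c + v u) ∂(haarProbability G)) *
        (c + ∫⁻ u, v u ∂(haarProbability G)) ^ (L ^ 2 - 2) ≤
      ∫⁻ U, Φ (plaquetteHolonomy U p 0 1) * Ψ (plaquetteHolonomy U p' 0 1) *
          ∏ x, (c + v (plaquetteHolonomy U x 0 1)) ∂(Measure.pi fun _ : Edge 2 L => haarProbability G) +
        (∫⁻ u, Φ u * (c + v u) ∂(haarProbability G)) * (∫⁻ u, Ψ u * (c + v u) ∂(haarProbability G)) *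
          (∫⁻ u, v u ∂(haarProbability G)) ^ (L ^ 2 - 2) := by
  classical
  obtain ⟨hpB, hp'B, hBcard⟩ := bulk_props (L := L) hpp'
  set B := (Finset.univ.erase p).erase p' with hB
  set a := ∫⁻ u, Φ u * (c + v u) ∂(haarProbability G) with ha
  set b := ∫⁻ u, Ψ u * (c + v u) ∂(haarProbability G) with hb
  set y := ∫⁻ u, v u ∂(haarProbability G) with hy
  have hw : Measurable fun u => c + v u := measurable_const.add hv
  have hΦw : Measurable fun u => Φ u * (c + v u) := hΦ.mul hw
  have hΨw : Measurable fun u => Ψ u * (c + v u) := hΨ.mul hw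
  set T : Finset (Site 2 L) → ℝ≥0∞ := fun t =>
    ∫⁻ U, Φ (plaquetteHolonomy U p 0 1) * (c + v (plaquetteHolonomy U p 0 1)) *
        (Ψ (plaquetteHolonomy U p' 0 1) * (c + v (plaquetteHolonomy U p' 0 1))) *
      ∏ x ∈ t, v (plaquetteHolonomy U x 0 1) ∂(Measure.pi fun _ : Edge 2 L => haarProbability G) with hT
  have hmeasT : ∀ t : Finset (Site 2 L), Measurable fun U : GaugeConfig 2 L G =>
      Φ (plaquetteHolonomy U p 0 1) * (c + v (plaquetteHolonomy U p 0 1)) *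
        (Ψ (plaquetteHolonomy U p' 0 1) * (c + v (plaquetteHolonomy U p' 0 1))) *
      ∏ x ∈ t, v (plaquetteHolonomy U x 0 1) := fun t =>
    ((hΦw.comp (measurable_plaquetteHolonomy p)).mul (hΨw.comp (measurable_plaquetteHolonomy p'))).mul
      (Finset.measurable_prod _ fun i _ => hv.comp (measurable_plaquetteHolonomy i))
  have hN : ∫⁻ U, Φ (plaquetteHolonomy U p 0 1) * Ψ (plaquetteHolonomy U p' 0 1) *
        ∏ x, (c + v (plaquetteHolonomy U x 0 1)) ∂(Measure.pi fun _ : Edge 2 L => haarProbability G) =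
      ∑ t ∈ B.powerset, c ^ (B.card - t.card) * T t := by
    have h1 : ∀ U : GaugeConfig 2 L G, Φ (plaquetteHolonomy U p 0 1) * Ψ (plaquetteHolonomy U p' 0 1) *
        ∏ x, (c + v (plaquetteHolonomy U x 0 1)) = ∑ t ∈ B.powerset, c ^ (B.card - t.card) *
          (Φ (plaquetteHolonomy U p 0 1) * (c + v (plaquetteHolonomy U p 0 1)) *
            (Ψ (plaquetteHolonomy U p' 0 1) * (c + v (plaquetteHolonomy U p' 0 1))) *
          ∏ x ∈ t, v (plaquetteHolonomy U x 0 1)) := fun U =>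
      pair_weight_expansion hpp' c v Φ Ψ (fun x => plaquetteHolonomy U x 0 1)
    simp_rw [h1]
    rw [lintegral_finsetSum _ fun t _ => (hmeasT t).const_mul _]
    refine Finset.sum_congr rfl fun t _ => ?_
    rw [lintegral_const_mul _ (hmeasT t)]
  have hgood : ∀ t ∈ B.powerset, t ≠ B → T t = a * b * y ^ t.card := by
    intro t ht hne
    have hsub : t ⊆ B := Finset.mem_powerset.mp ht
    obtain ⟨x₁, hx₁B, hx₁t⟩ := Finset.exists_of_ssubset (Finset.ssubset_iff_subset_ne.mpr ⟨hsub, hne⟩)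
    have hx₁p : x₁ ≠ p := fun h => hpB (h ▸ hx₁B)
    have hx₁p' : x₁ ≠ p' := fun h => hp'B (h ▸ hx₁B)
    rw [hT]
    simp only
    rw [lintegral_pair_prod_eq_pi hL t hx₁t hx₁p hx₁p' hΦw hΨw hv,
      lintegral_pi_pair_prod hpp' t (fun h => hpB (hsub h)) (fun h => hp'B (hsub h)) hΦw hΨw hv]
  have hBmem : B ∈ B.powerset := Finset.mem_powerset.mpr (Finset.Subset.refl _)
  have hbinom : ∑ t ∈ B.powerset, c ^ (B.card - t.card) * (a * b * y ^ t.card) = a * b * (c + y) ^ (L ^ 2 - 2) := by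
    rw [← hBcard, add_comm c y, ← Finset.sum_pow_mul_eq_add_pow y c B, Finset.mul_sum]
    refine Finset.sum_congr rfl fun t _ => ?_
    ring
  have hsum : ∑ t ∈ B.powerset.erase B, c ^ (B.card - t.card) * (a * b * y ^ t.card) =
      ∑ t ∈ B.powerset.erase B, c ^ (B.card - t.card) * T t :=
    Finset.sum_congr rfl fun t ht => by
      rw [hgood t (Finset.mem_of_mem_erase ht) (Finset.ne_of_mem_erase ht)]
  rw [hN, ← hbinom, ← Finset.sum_erase_add _ _ hBmem,
    ← Finset.sum_erase_add B.powerset (fun t => c ^ (B.card - t.card) * T t) hBmem, hsum,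
    Nat.sub_self, pow_zero, one_mul, one_mul, hBcard]
  have hfin : ∑ t ∈ B.powerset.erase B, c ^ (L ^ 2 - 2 - t.card) * T t ≤
      ∑ t ∈ B.powerset.erase B, c ^ (L ^ 2 - 2 - t.card) * T t + T B := le_self_add
  exact add_le_add_left hfin _

end Summit.Ventures.LatticeQCDFlow.Theory2.Lattice.TwoDim

end
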